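import Summits.HodgeConjecture.CorCM.SexticOcticWeilFourfoldParts
import Summits.HodgeConjecture.CorCM.OcticCurveFourfoldWeilParts
import HarnessLib

/-!
# COR-CM — `E × T × B` over a sextic and an octic CM field sharing `k`: the sub-product `B ⊞ E ⊞ E` of `Y⁺ = E ⊞ Y` and its six-point weights
# of constant sign — algebraic GIVEN the Weil plane of `(B × E) × E` (the input of the sixfold parts)

Cell `pub-hodgecm2` (COR-CM), seat b30 gen 26 (2026-08-23); count-neutral own lane SEXTIC-OCTIC; sequel of
`CorCM/SexticOcticWeilFourfoldParts.lean`.  Theorems + two bookkeeping definitions (the re-slotting map `consSlot₃` and the sub-product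
`fold₆`); no named fact, no `sorry`: the Weil plane of `((B × E) × E, (ι(i₂δ) × ι(δ)) × ι(δ))` enters as the HYPOTHESIS `hW₃` (discharged
downstream from `Markman2025_weilClasses_algebraic_hyperbolicSixfold` by gen 18's `OcticCurveFourfold.weilClassesOf_le_algebraicClasses_
cmFourfold_prod_cmCurve_prod_cmCurve_of_markmanSixfold`).  The three-slot twin of gen 25's `CorCM/OcticWeilMultiSixfoldSubproduct.lean`
(gen 18's RE-SLOTTING device: the model map is NOT injective on a sixfold part — two curve points — so the second curve copy is moved to
the fresh slot of `Y⁺ = E ⊞ Y` before projecting).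

* §1 `consSlot₃ = (0; 0, 1, 2)` (`Fin.cons 0 id : Fin 4 → Fin 3`: a SECOND curve slot in front), `fold₆ = (3, 1, 0)` (the sub-product
  `B ⊞ E ⊞ E` of `Y⁺`), `fst_eq_zero_of_toPtS_eq_inl`;
* §2 `weightClassesAlg_three_le_algebraicClasses_of_signS₆` — a six-point weight of `B ⊞ E ⊞ E` of constant sign lies in a Weil eigenline
  (`PairWeights.weightClassesAlg_le_weilClassesPlus/Minus`), algebraic by `hW₃` transported to `⨁`
  (`OcticCurveFourfold.weilClassesOf_biproduct₃_le_algebraicClasses_of_prod`);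
* §3 `IsSixPartS.exists_pair` / `IsSixPartS.eq_of_inr` (the two curve points; injectivity off the curve labels).
HONEST FRAMING: nothing about the Hodge conjecture is concluded here; `HC_CM` is not asserted.
[cite: Deligne1982HodgeCycles, §5 (c)] [cite: vanGeemen1994HodgeAV, 4.9] [cite: MoonenZarhin1995Duke, Thm. 2.4]

## References
* [Deligne1982HodgeCycles] P. Deligne, LNM 900 (1982), §5 (c).  [vanGeemen1994HodgeAV] B. van Geemen, LNM 1594 (1994), 3.6–3.7,
  4.9.  [MoonenZarhin1995Duke] B. Moonen, Yu. Zarhin, Duke Math. J. 77 (1995), Thm. 2.4.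
-/

noncomputable section

open CategoryTheory CategoryTheory.Limits NumberField

namespace Summit.HodgeConjecture.CorCM.SexticOcticWeil

open Literature.AlgebraicGeometry Literature.AlgebraicGeometry.Motives Literature.AlgebraicGeometry.HodgeTheory
open Literature.AlgebraicGeometry.ComplexMultiplication (IsCMTypeRealisation)
open Literature.AlgebraicGeometry.Pohlmann1968
open Literature.AlgebraicTopology.SingularHomology
open Literature.NumberTheory.ComplexMultiplication
open Summit.HodgeConjecture.CorCM.Census.SexticOcticWeil (PtS IsSixPartS)
open Summit.HodgeConjecture.CorCM.OcticCurveFourfold (weilClassesOf_biproduct₃_le_algebraicClasses_of_prod)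
open Summit.HodgeConjecture.CorCM.PairWeights

open scoped Classical

/-! ## §1 The re-slotting map, the sub-product -/

/-- **A second curve slot in front of `Y = E ⊞ T ⊞ B`**: `consSlot₃ = (0; 0, 1, 2)` as `Fin.cons`, so that `consSlot₃ 0` is DEFINITIONALLY
the curve slot `0` and `consSlot₃ l.succ` is DEFINITIONALLY `l` (`Y⁺ = E ⊞ Y = ⨁_l A(consSlot₃ l)`). [folklore] -/
def consSlot₃ : Fin 4 → Fin 3 := Fin.cons 0 fun l : Fin 3 => l

/-- `consSlot₃ 0 = 0`. [folklore] -/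
@[simp] theorem consSlot₃_zero : consSlot₃ 0 = 0 := rfl

/-- `consSlot₃ (l+1) = l`. [folklore] -/
@[simp] theorem consSlot₃_succ (l : Fin 3) : consSlot₃ l.succ = l := rfl

/-- The three-factor sub-product `(3, 1, 0)` of `Y⁺`: `B ⊞ E ⊞ E` (fourfold FIRST, as in gen 18's sixfold `(B × E) × E`). [folklore] -/
def fold₆ : Fin 3 → Fin 4 := ![(2 : Fin 3).succ, (0 : Fin 3).succ, 0]

/-- `fold₆` is injective. [folklore] -/
theorem fold₆_injective : Function.Injective fold₆ := by
  intro a b h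
  fin_cases a <;> fin_cases b <;> first | rfl | exact absurd h (by decide)

/-- The range of `fold₆` is `{3, 1, 0}`. [folklore] -/
theorem mem_range_fold₆ {l : Fin 4} (h : l = (2 : Fin 3).succ ∨ l = (0 : Fin 3).succ ∨ l = 0) : l ∈ Set.range fold₆ := by
  rcases h with rfl | rfl | rfl; exacts [⟨0, rfl⟩, ⟨1, rfl⟩, ⟨2, rfl⟩]

section Sixfold

variable {I : Type} {Kf : I → Type} [∀ i, Field (Kf i)] [∀ i, NumberField (Kf i)]
  {i₀ i₁ i₂ : I} {e₁ : (Kf i₁ →+* ℂ) ≃ Fin 3 × Bool} {e₂ : (Kf i₂ →+* ℂ) ≃ Fin 4 × Bool} {τ : Kf i₀ →+* ℂ}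
  {i₁' : Kf i₀ →+* Kf i₁} {i₂' : Kf i₀ →+* Kf i₂}
  (hk : ∀ σ : Kf i₀ →+* ℂ, σ = τ ∨ σ = ComplexEmbedding.conjugate τ)
  (he₁_sign : ∀ s : Kf i₁ →+* ℂ, (e₁ s).2 = true ↔ s.comp i₁' = τ)
  (he₂_sign : ∀ t : Kf i₂ →+* ℂ, (e₂ t).2 = true ↔ t.comp i₂' = τ)
  {A : Fin 3 → AbelianVariety ℂ} {Φ : ∀ j : Fin 3, CMType (Kf (soSlots i₀ i₁ i₂ j))}
  {ι : ∀ j, 𝓞 (Kf (soSlots i₀ i₁ i₂ j)) →+* End (A j)}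
  {θ : ∀ j, Kf (soSlots i₀ i₁ i₂ j) →+* Module.End ℂ (complexBetti (A j).X 1)}
  (hA : ∀ j, IsCMTypeRealisation (Φ j) (A j) (ι j) (θ j))
  {δ : 𝓞 (Kf i₀)} {d : ℕ} (hτ : τ (δ : Kf i₀) = Complex.I * (Real.sqrt d : ℂ))

/-! ## §2 A six-point weight of `B ⊞ E ⊞ E` of constant sign is algebraic, given the Weil plane -/

omit [∀ i, NumberField (Kf i)] in
include hk he₁_sign he₂_sign hτ in
/-- **A six-point weight of `Y₃ = B ⊞ E ⊞ E` (the sub-product `fold₆` of `Y⁺`) of constant sign has an algebraic line, GIVEN the Weil plane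
of the sixfold.**  All six points have eigenvalue `±i√d` on `(i₂δ, δ, δ)`, so the line lies in a Weil eigenline
(`PairWeights.weightClassesAlg_le_weilClassesPlus/Minus`) `⊆ W ⊗ ℂ`, algebraic by `hW₃` transported to `⨁`.
[cite: vanGeemen1994HodgeAV, 4.9] [cite: Deligne1982HodgeCycles, §5 (c)] -/
theorem weightClassesAlg_three_le_algebraicClasses_of_signS₆
    (hW₃ : weilClassesOf (((A 2).prod (A 0)).prod (A 0))
      (AbelianVariety.prodLift
        (AbelianVariety.fst ((A 2).prod (A 0)) (A 0) ≫
          AbelianVariety.prodLift (AbelianVariety.fst (A 2) (A 0) ≫ ι 2 (RingOfIntegers.mapRingHom i₂' δ))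
            (AbelianVariety.snd (A 2) (A 0) ≫ ι 0 δ))
        (AbelianVariety.snd ((A 2).prod (A 0)) (A 0) ≫ ι 0 δ)) 3 d ≤
      algebraicClasses (((A 2).prod (A 0)).prod (A 0)).X 3)
    (b : Bool) (T : Finset ((l : Fin 3) × (Kf (soSlots i₀ i₁ i₂ (consSlot₃ (fold₆ l))) →+* ℂ))) (hTcard : T.card = 2 * 3)
    (hsgn : ∀ z ∈ T, toPtS e₁ e₂ τ ⟨consSlot₃ (fold₆ z.1), z.2⟩ = Sum.inl b ∨
      ∃ a : Fin 4, toPtS e₁ e₂ τ ⟨consSlot₃ (fold₆ z.1), z.2⟩ = Sum.inr (Sum.inr (a, b))) :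
    weightClassesAlg (fun l => A (consSlot₃ (fold₆ l))) (fun l => ι (consSlot₃ (fold₆ l))) (2 * 3) T ≤
      algebraicClasses (⨁ fun l => A (consSlot₃ (fold₆ l))).X 3 := by
  -- the family `(i₂δ, δ, δ)` on the three slots, as the restriction of `(δ; i₁δ, i₂δ)`
  let aY : ∀ j : Fin 3, 𝓞 (Kf (soSlots i₀ i₁ i₂ j)) :=
    Fin.cons δ (Fin.cons (RingOfIntegers.mapRingHom i₁' δ) fun _ : Fin 1 => RingOfIntegers.mapRingHom i₂' δ)
  let a₃ : ∀ l : Fin 3, 𝓞 (Kf (soSlots i₀ i₁ i₂ (consSlot₃ (fold₆ l)))) := fun l => aY (consSlot₃ (fold₆ l))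
  have hval : ∀ z ∈ T, z.2 ((a₃ z.1 : 𝓞 (Kf (soSlots i₀ i₁ i₂ (consSlot₃ (fold₆ z.1))))) :
      Kf (soSlots i₀ i₁ i₂ (consSlot₃ (fold₆ z.1)))) = if b then Complex.I * (Real.sqrt d : ℂ) else -(Complex.I * (Real.sqrt d : ℂ)) :=
    fun z hz => apply_eq_of_signS hk he₁_sign he₂_sign hτ ⟨consSlot₃ (fold₆ z.1), z.2⟩ b (by
      rcases hsgn z hz with h | h
      · exact Or.inl h
      · exact Or.inr (Or.inr h))
  -- the Weil plane of `⨁_l A(consSlot₃ (fold₆ l))`, algebraic by `hW₃`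
  have hWeil : weilClassesOf (⨁ fun l => A (consSlot₃ (fold₆ l))) (biproduct.map fun l => ι (consSlot₃ (fold₆ l)) (a₃ l)) 3 d ≤
      algebraicClasses (⨁ fun l => A (consSlot₃ (fold₆ l))).X 3 :=
    weilClassesOf_biproduct₃_le_algebraicClasses_of_prod (A := fun l => A (consSlot₃ (fold₆ l)))
      (fun l => ι (consSlot₃ (fold₆ l)) (a₃ l)) hW₃
  cases b
  · refine (weightClassesAlg_le_weilClassesMinus (K := fun l => Kf (soSlots i₀ i₁ i₂ (consSlot₃ (fold₆ l))))
      (A := fun l => A (consSlot₃ (fold₆ l))) (ι := fun l => ι (consSlot₃ (fold₆ l))) a₃ hTcard fun z hz => ?_).trans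
      ((weilClassesMinus_le_weilClassesOf _ _ 3 d).trans hWeil)
    simpa using hval z hz
  · refine (weightClassesAlg_le_weilClassesPlus (K := fun l => Kf (soSlots i₀ i₁ i₂ (consSlot₃ (fold₆ l))))
      (A := fun l => A (consSlot₃ (fold₆ l))) (ι := fun l => ι (consSlot₃ (fold₆ l))) a₃ hTcard fun z hz => ?_).trans
      ((weilClassesPlus_le_weilClassesOf _ _ 3 d).trans hWeil)
    simpa using hval z hz

omit [∀ i, NumberField (Kf i)] in
include hk in
/-- A curve point of the index set: `toPtS x = inl b` forces slot `0` and the embedding `τ_b`. [folklore] -/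
theorem fst_eq_zero_of_toPtS_eq_inl {x : (l : Fin 3) × (Kf (soSlots i₀ i₁ i₂ l) →+* ℂ)} {b : Bool} (hx : toPtS e₁ e₂ τ x = Sum.inl b) :
    ∃ σ : Kf i₀ →+* ℂ, x = ⟨0, σ⟩ ∧ σ = if b then τ else ComplexEmbedding.conjugate τ := by
  rcases sigma_cases₃ x with ⟨σ, rfl⟩ | ⟨s, rfl⟩ | ⟨t, rfl⟩
  · refine ⟨σ, rfl, ?_⟩
    rw [toPtS_zero, Sum.inl.injEq] at hx
    cases b
    · rw [if_neg Bool.false_ne_true]; exact (hk σ).resolve_left (of_decide_eq_false hx)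
    · rw [if_pos rfl]; exact of_decide_eq_true hx
  · rw [toPtS_one] at hx; exact absurd hx Sum.inr_ne_inl
  · rw [toPtS_two] at hx; exact absurd hx Sum.inr_ne_inl

omit [∀ i, NumberField (Kf i)] in
/-- A fourfold point of the index set: `toPtS x = inr (inr q)` forces slot `2`. [folklore] -/
theorem fst_eq_two_of_toPtS_eq_inr_inr {x : (l : Fin 3) × (Kf (soSlots i₀ i₁ i₂ l) →+* ℂ)} {q : Fin 4 × Bool}
    (hx : toPtS e₁ e₂ τ x = Sum.inr (Sum.inr q)) : x.1 = 2 := by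
  rcases sigma_cases₃ x with ⟨σ, rfl⟩ | ⟨s, rfl⟩ | ⟨t, rfl⟩
  · rw [toPtS_zero] at hx; exact absurd hx Sum.inl_ne_inr
  · rw [toPtS_one, Sum.inr.injEq] at hx; exact absurd hx Sum.inl_ne_inr
  · rfl

/-! ## §3 The two curve points of a sixfold part; injectivity off the curve labels -/

omit [∀ i, NumberField (Kf i)] in
/-- A sixfold part has two distinct curve points. [folklore] -/
theorem _root_.Summit.HodgeConjecture.CorCM.Census.SexticOcticWeil.IsSixPartS.exists_pair {α : Type*} {v : α → PtS} {b : Bool}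
    {G : Finset α} (hG : IsSixPartS v b G) : ∃ x₁ ∈ G, ∃ x₂ ∈ G, x₁ ≠ x₂ ∧ v x₁ = Sum.inl b ∧ v x₂ = Sum.inl b := by
  obtain ⟨x₁, x₂, hne, h12⟩ := Finset.card_eq_two.1 hG.2.1
  have h1 : x₁ ∈ G.filter fun x => v x = Sum.inl b := by rw [h12]; simp
  have h2 : x₂ ∈ G.filter fun x => v x = Sum.inl b := by rw [h12]; simp
  exact ⟨x₁, (Finset.mem_filter.1 h1).1, x₂, (Finset.mem_filter.1 h2).1, hne, (Finset.mem_filter.1 h1).2,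
    (Finset.mem_filter.1 h2).2⟩

omit [∀ i, NumberField (Kf i)] in
/-- In a sixfold part, two points over the same fourfold label coincide. [folklore] -/
theorem _root_.Summit.HodgeConjecture.CorCM.Census.SexticOcticWeil.IsSixPartS.eq_of_inr {α : Type*} {v : α → PtS} {b : Bool}
    {G : Finset α} (hG : IsSixPartS v b G) {x x' : α} (hx : x ∈ G) (hx' : x' ∈ G) {q : Fin 4 × Bool}
    (hq : v x = Sum.inr (Sum.inr q)) (hq' : v x' = Sum.inr (Sum.inr q)) : x = x' := by
  classical
  obtain ⟨a, ha⟩ : ∃ a : Fin 4, v x = Sum.inr (Sum.inr (a, b)) := by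
    rcases hG.mem_cases hx with h | h
    · rw [hq] at h; exact absurd h Sum.inr_ne_inl
    · exact h
  have hqa : q = (a, b) := by rw [hq] at ha; exact Sum.inr.inj (Sum.inr.inj ha)
  subst hqa
  obtain ⟨z, hz⟩ := Finset.card_eq_one.1 (hG.2.2 a)
  have hxz : x ∈ G.filter fun x => v x = Sum.inr (Sum.inr (a, b)) := Finset.mem_filter.2 ⟨hx, hq⟩
  have hx'z : x' ∈ G.filter fun x => v x = Sum.inr (Sum.inr (a, b)) := Finset.mem_filter.2 ⟨hx', hq'⟩
  rw [hz, Finset.mem_singleton] at hxz hx'z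
  rw [hxz, hx'z]

end Sixfold

end Summit.HodgeConjecture.CorCM.SexticOcticWeil

end
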